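import Literature.MathematicalPhysics.QuantumFieldTheory.Balaban1983to89.B14Claim247Soft
import Literature.MathematicalPhysics.QuantumFieldTheory.Balaban1983to89.B12ContourAverage253

/-!
# `Balaban1983to89.B14Claim247Avg` — T. Bałaban, *Convergent renormalization expansions for lattice gauge theories*, Commun. Math. Phys. **119** (1988) 243–285 [Balaban1988Convergent]: the claim of p. 247, `|U U_{1,□′}⁻¹ − 1| < O(L²)ε₀` on `□′^{~2}`, with the soft axial gauge `χ_Ax` of (1.5)–(1.6) imposed — AS PRINTED — on the Euclidean-invariant AVERAGED CONTOUR VARIABLES `𝐔(y,x) = M({U(Γ)}_{Γ∈𝐆(y,x)})` of [Balaban1987RG1] (0.11): deviation (D1′) of `B14Claim247Soft` REMOVED (seat p26, Phase-2 continuation of row **B14.Claim@247**)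

statement-level skeleton of published theorems with citation tags; proofs where landed; nothing here is a claim about the Yang–Mills mass gap

PDF held: `paper:balaban1988-cmp119-convergent-renormalization` (journal page = PDF page + 242; p. 247 = PDF p. 5, text layer
re-read for this file); `paper:balaban1987-cmp109-rg-i-small-field` ((0.5)–(0.11) pp. 252–254 = PDF pp. 4–6).

WHAT IS REPRODUCED (mega-formalization `lit-balaban`, HOME `run/shared/lean/pub/lit-balaban/`, Phase-2 seat p26, generation 7;
SKELETON row **B14.Claim@247**, owner r11).  [Balaban1988Convergent] p. 247: *"χ_Ax = ∏_{y∈P₁¹} ∏_{x∈B(y), x≠y} χ({|U(y,x) − 1| <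
ε₀}), (1.5) … U(y, x) are the contour variables (0.11) [I]. … A good approximation on a cube □′ ⊂ B(P₁¹) is given by UU_{1,□′}⁻¹,
where U_{1,□′} is taken in the axial gauge. It is easy to see, by the same reasoning as in the proof of Lemma 1 [14], that
|UU_{1,□′}⁻¹ − 1| < O(L²)ε₀ on □′^{~2}."*  [Balaban1987RG1] p. 253: *"we introduce the averaged contour variable corresponding to
the set of contours 𝐆(y, x), 𝐔(y, x) = M({𝐔(Γ)}_{Γ∈𝐆(y,x)}). (0.11)"*, `M` = Federbush's mean (0.10), `𝐆(y,x)` = the shortest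
contours of p. 252 (one per ordering of the axes).  The landed `B14Claim247Soft` (generation 1) typed the `χ_Ax` restriction on
the TREE contour variable `U(Γ_{y,x})` ([III] p. 247 ll. 12–20 names that alternative) and recorded the averaged variables as
deviation (D1′), keeping the discrepancy `τ` free in `lemma1_soft`.  THIS FILE imposes `χ_Ax` on the AVERAGED variables as printed:
  §1 `avgAxialFn U y x` = `𝐔(y,x)` — Federbush's mean (`B12ContourAverage253.fedAvg`, the tree's (0.10) of record, BY NAME) of the
`d!` transporters `U(Γ^π_{y,x})` (`B12ContourAverage253.permWord`, the family `𝐆(y,x)` of record, BY NAME), based at the tree contour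
`π = 1`; §2 **`norm_axialFn_sub_one_le_of_avg`**: if `‖𝐔(y,x) − 1‖ ≤ ε₀` and the plaquettes of the box `[y, x]` are `a`-small
with `(|x − y|₁)²a ≤ 1/100`, then `‖U(Γ_{y,x}) − 1‖ ≤ ε₀ + 4(|x − y|₁)²a` (the family has diameter `(|x−y|₁)²a`,
`B12ContourAverage253.norm_perm_rel_sub_one_le`, so the mean is `4(|x−y|₁)²a`-close to `U(Γ_{y,x})`,
`B12ContourAverage253.norm_fedAvg_mul_inv_sub_one_le` — both BY NAME — and `U(Γ) − 1 = (𝐔 − 1) − (𝐔U(Γ)⁻¹ − 1)U(Γ)`);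
§3 `Hyp247Avg` = `B14Claim247Soft.Hyp247Soft` with the two soft-axial fields replaced by the PRINTED ones on `𝐔(z,x)`, `z = c₋, c₊`;
**`Hyp247Avg.toHypSoft`**: under `(dL)²ε₀ ≤ 1/100` it is `HypSoft … ε₀ 0 (ε₀ + 4(dL)²ε₀)`, hence **`claim247_avg_explicit`**:
`‖U_bU₁,b⁻¹ − 1‖ ≤ 10(d−1)(L−1)Lε₀ + 2ε₀ + 8(dL)²ε₀` on every bond of the block pair; §4 **`Claim247AvgPrinted`** (the printed form,
`∃ C c > 0 …` as `Claim247SoftPrinted` with `Hyp247Avg`) and **`Claim247AvgPrinted_holds`** with `C = 8d² + 10d + 1`, `c = 1/(100(d+1)²)`.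

HONEST SCOPE / DEVIATIONS.  (a) `M` is Federbush's mean (0.10) in the tree's form `fedAvg` (base point = the tree contour; the
independence of the base point and (0.5)–(0.7) are PROVED in `B12ContourAverage253`, not re-proved here); `𝐆(y,x)` = all `d!` axis
orderings (orderings differing only on axes with `x_μ = y_μ` give the same contour; `B12ContourAverage253` DIVERGENCE (b)); the value
algebra is a complete normed `ℂ`-algebra `𝔸` with `‖1‖ = 1` and the fields `U1 𝔸`-valued (`⊇ U(N)`), as in the whole b12/b08 lineage.
(b) `≤ ε₀` where (1.5) prints `< ε₀` (formally stronger hypothesis-wise weaker conclusion `≤`/`<` as in `B14Claim247Soft`); (D2), (D3)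
of `B14Claim247` unchanged (block-pair model of [14] Lemma 1, plaquette constant `ε₀` for both fields).  (c) The dictionary
`avgAxialFn U (L·y₀) x = B12ContourAverage253.Tavg L (uncurry U) x` for `x ∈ B(y₀)` (b12's corner-cube blocks) is
`avgAxialFn_eq_Tavg`.  Every declaration is a definition with a body or a proved theorem; net new unproved facts 0.  Unit
`lit-balaban-p26` (literature-prover-lit-balaban-p26-g7-0).
-/

noncomputable section

open scoped BigOperators
open NormedSpace Finset

namespace Literature.MathematicalPhysics.QuantumFieldTheory.Balaban1983to89.B14Claim247Avg

open B7Prop1Explicit B8Lemma1NonAbelian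
open B8Lemma1Lattice (InBlock)
open B14.Claim247 (ten_omegaC_le)
open B14Claim247Soft (HypSoft Hyp247Soft lemma1_soft Claim247SoftPrinted)
open B12ContourAverage253 (permWord permWord_one fedAvg rel norm_perm_rel_sub_one_le norm_fedAvg_mul_inv_sub_one_le
  permT Tavg permT_eq_of_mem)

variable {d : ℕ}

/-! ## §1 The averaged contour variable `𝐔(y,x)` of (0.11) [I] on the `ℤ^d` carriers -/

section Average

variable {𝔸 : Type*} [NormedRing 𝔸] [NormOneClass 𝔸] [NormedAlgebra ℂ 𝔸] [CompleteSpace 𝔸]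

/-- **[Balaban1987RG1] (0.11): `𝐔(y, x) = M({U(Γ)}_{Γ ∈ 𝐆(y,x)})`** — Federbush's mean (0.10) (the tree's `fedAvg`, based at the
tree contour `π = 1`) of the transporters along the `d!` shortest contours `Γ^π_{y,x}` of p. 252 (`permWord π (x − y)` from `y`).
[cite: Balaban1987RG1, (0.11) p.253] -/
def avgAxialFn (U : B7Prop1Explicit.Site d → Fin d → 𝔸ˣ) (y x : B7Prop1Explicit.Site d) : 𝔸ˣ :=
  fedAvg (fun π : Equiv.Perm (Fin d) => hol U y (permWord π (x - y))) 1

omit [NormOneClass 𝔸] [NormedAlgebra ℂ 𝔸] [CompleteSpace 𝔸] in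
/-- The member `π = 1` of the family is the tree contour variable `U(Γ_{y,x})` (`axialFn U y x`, [2] (1.7)).
[cite: Balaban1987RG1, p.252] -/
theorem hol_permWord_one (U : B7Prop1Explicit.Site d → Fin d → 𝔸ˣ) (y x : B7Prop1Explicit.Site d) : hol U y (permWord 1 (x - y)) = axialFn U y x := by
  rw [permWord_one]; rfl

omit [NormOneClass 𝔸] in
/-- **Dictionary to the b12 lineage's object of record**: on b12's corner-cube block `B(y₀) = L·y₀ + [0, L)^d`, the averaged
variable based at the block corner IS `B12ContourAverage253.Tavg L (uncurry U)`. [cite: Balaban1987RG1, (0.11) p.253] -/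
theorem avgAxialFn_eq_Tavg {L : ℕ} (hL : 0 < L) (U : B7Prop1Explicit.Site d → Fin d → 𝔸ˣ) {y₀ x : B7Prop1Explicit.Site d}
    (hx : x ∈ QuantumLattice.blockSites L y₀) :
    avgAxialFn U (QuantumLattice.blockBase L y₀) x = Tavg L (Function.uncurry U) x := by
  unfold avgAxialFn Tavg
  congr 1
  funext π
  rw [permT_eq_of_mem hL _ hx]
  rfl

/-! ## §2 `χ_Ax` on the averaged variable controls the tree contour variable -/

/-- **If `‖𝐔(y,x) − 1‖ ≤ ε₀` and the plaquettes of a box `[lo, hi] ⊇ [y, x]` are `a`-small with `(|x − y|₁)²·a ≤ 1/100`, then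
`‖U(Γ_{y,x}) − 1‖ ≤ ε₀ + 4(|x − y|₁)²a`.**  The family `{U(Γ^π_{y,x})}_π` has diameter `(|x−y|₁)²a` seen from the tree contour
(`norm_perm_rel_sub_one_le`: each contour differs from `Γ_{y,x}` by `≤ |x−y|₁` bonds, each `|x−y|₁a`-close to `1` in the axial
gauge at `y`), so Federbush's mean is `4(|x−y|₁)²a`-close to `U(Γ_{y,x})` (`norm_fedAvg_mul_inv_sub_one_le`); and `U(Γ) − 1 =
(𝐔 − 1) − (𝐔U(Γ)⁻¹ − 1)·U(Γ)` with `‖U(Γ)‖ ≤ 1`. [cite: Balaban1988Convergent, (1.5) p.247] -/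
theorem norm_axialFn_sub_one_le_of_avg {U : B7Prop1Explicit.Site d → Fin d → 𝔸ˣ} (hU : ∀ x κ, U x κ ∈ U1 𝔸) {lo hi : B7Prop1Explicit.Site d} {a : ℝ}
    (hP : B8Lemma1NonAbelian.PlaqSmall U lo hi a) (ha : 0 ≤ a) {y x : B7Prop1Explicit.Site d} (hyx : y ≤ x) (hlo : lo ≤ y) (hhi : x ≤ hi)
    (hsm : (l1 (x - y) : ℝ) * ((l1 (x - y) : ℝ) * a) ≤ 1 / 100) {ε₀ : ℝ}
    (hAx : ‖((avgAxialFn U y x : 𝔸ˣ) : 𝔸) - 1‖ ≤ ε₀) :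
    ‖((axialFn U y x : 𝔸ˣ) : 𝔸) - 1‖ ≤ ε₀ + 4 * ((l1 (x - y) : ℝ) * ((l1 (x - y) : ℝ) * a)) := by
  set F : Equiv.Perm (Fin d) → 𝔸ˣ := fun π => hol U y (permWord π (x - y)) with hF
  have hv : (0 : B7Prop1Explicit.Site d) ≤ x - y := sub_nonneg.mpr hyx
  have hhi' : y + (x - y) ≤ hi := by rw [add_sub_cancel]; exact hhi
  have hrel : ∀ π, ‖rel F 1 π - 1‖ ≤ (l1 (x - y) : ℝ) * ((l1 (x - y) : ℝ) * a) := fun π => by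
    have h := norm_perm_rel_sub_one_le U hU hP ha (q := y) (v := x - y) hv hlo hhi' π
    rw [rel, ← Units.val_mul, hF]
    simpa only [permWord_one] using h
  have hX := norm_fedAvg_mul_inv_sub_one_le hsm hrel
  -- `X := 𝐔 U(Γ)⁻¹`, `g := U(Γ)`: `g − 1 = (𝐔 − 1) − (X − 1) g`
  have hF1 : F 1 = axialFn U y x := hol_permWord_one U y x
  have hT : fedAvg F 1 = avgAxialFn U y x := rfl
  rw [hF1, hT] at hX
  set X : 𝔸ˣ := avgAxialFn U y x * (axialFn U y x)⁻¹ with hXdef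
  have hid : ((axialFn U y x : 𝔸ˣ) : 𝔸) - 1 =
      (((avgAxialFn U y x : 𝔸ˣ) : 𝔸) - 1) - (((X : 𝔸ˣ) : 𝔸) - 1) * ((axialFn U y x : 𝔸ˣ) : 𝔸) := by
    have hXg : ((X : 𝔸ˣ) : 𝔸) * ((axialFn U y x : 𝔸ˣ) : 𝔸) = ((avgAxialFn U y x : 𝔸ˣ) : 𝔸) := by
      rw [← Units.val_mul, hXdef, inv_mul_cancel_right]
    rw [sub_mul, hXg, one_mul]; abel
  have hg1 : ‖((axialFn U y x : 𝔸ˣ) : 𝔸)‖ ≤ 1 := (mem_U1.mp (axialFn_mem hU y x)).1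
  rw [hid]
  calc _ ≤ ‖((avgAxialFn U y x : 𝔸ˣ) : 𝔸) - 1‖ + ‖(((X : 𝔸ˣ) : 𝔸) - 1) * ((axialFn U y x : 𝔸ˣ) : 𝔸)‖ := norm_sub_le _ _
    _ ≤ ε₀ + ‖((X : 𝔸ˣ) : 𝔸) - 1‖ * 1 :=
        add_le_add hAx ((norm_mul_le _ _).trans (mul_le_mul_of_nonneg_left hg1 (norm_nonneg _)))
    _ ≤ _ := by rw [mul_one]; exact add_le_add le_rfl hX

/-- The same on a block `B(z) = z + [0, L)^d` of a configuration whose plaquettes are `ε₀`-small on a box containing the block,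
with the uniform constant `4(dL)²ε₀` (`|x − z|₁ ≤ dL`) and the smallness `(dL)²ε₀ ≤ 1/100`. [cite: Balaban1988Convergent, (1.5) p.247] -/
theorem norm_axialFn_sub_one_le_of_avg_block {L : ℕ} {U : B7Prop1Explicit.Site d → Fin d → 𝔸ˣ} (hU : ∀ x κ, U x κ ∈ U1 𝔸)
    {lo hi : B7Prop1Explicit.Site d} {ε₀ : ℝ} (hP : B8Lemma1NonAbelian.PlaqSmall U lo hi ε₀) (hε₀ : 0 ≤ ε₀) {z : B7Prop1Explicit.Site d} (r : Fin d → Fin L) (hlo : lo ≤ z)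
    (hhi : z + boxVec L r ≤ hi) (hsm : ((d : ℝ) * L) ^ 2 * ε₀ ≤ 1 / 100)
    (hAx : ‖((avgAxialFn U z (z + boxVec L r) : 𝔸ˣ) : 𝔸) - 1‖ ≤ ε₀) :
    ‖((axialFn U z (z + boxVec L r) : 𝔸ˣ) : 𝔸) - 1‖ ≤ ε₀ + 4 * (((d : ℝ) * L) ^ 2 * ε₀) := by
  have hl : (l1 (z + boxVec L r - z) : ℝ) ≤ (d : ℝ) * L := by
    rw [add_sub_cancel_left]; exact_mod_cast l1_boxVec_le L r
  have hl0 : (0 : ℝ) ≤ l1 (z + boxVec L r - z) := Nat.cast_nonneg _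
  have hll : (l1 (z + boxVec L r - z) : ℝ) * ((l1 (z + boxVec L r - z) : ℝ) * ε₀) ≤ ((d : ℝ) * L) ^ 2 * ε₀ := by
    rw [← mul_assoc, sq]
    exact mul_le_mul_of_nonneg_right (mul_le_mul hl hl hl0 (by positivity)) hε₀
  have h := norm_axialFn_sub_one_le_of_avg hU hP hε₀ (y := z) (x := z + boxVec L r)
    (le_add_of_nonneg_right (boxVec_nonneg L r)) hlo hhi (hll.trans hsm) hAx
  exact h.trans (by linarith)

end Average

/-! ## §3 The p. 247 claim with `χ_Ax` on the averaged contour variables -/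

section Model

variable {𝔸 : Type*} [NormedRing 𝔸] [NormOneClass 𝔸] [NormedAlgebra ℂ 𝔸] [CompleteSpace 𝔸]

/-- **The situation of p. 247 with the PRINTED gauge conditions** on a block pair `B(c₋) ∪ B(c₊)`, `c = ⟨y, y + Le_κ⟩`: as
`B14Claim247Soft.Hyp247Soft` (`U`, `U₁ = U_{1,□′}` `U1 𝔸`-valued, plaquettes `ε₀`-close to `1` on the pair, block-bond averages
agree, `U₁` in the axial gauge `U₁(Γ_{z,x}) = 1`), but the restriction on `U` is the printed `χ_Ax` of (1.5):
`|𝐔(z,x) − 1| < ε₀` (typed `≤`) for the AVERAGED contour variables (0.11) [I], `x ∈ B(z)`, `z = c₋, c₊`.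
[cite: Balaban1988Convergent, (1.5)–(1.6) p.247] -/
structure Hyp247Avg (L : ℕ) (U U₁ : B7Prop1Explicit.Site d → Fin d → 𝔸ˣ) (y : B7Prop1Explicit.Site d) (κ : Fin d) (ε₀ : ℝ) : Prop where
  memU : ∀ x μ, U x μ ∈ U1 𝔸
  memU₁ : ∀ x μ, U₁ x μ ∈ U1 𝔸
  plaqU : B8Lemma1NonAbelian.PlaqSmall U y (y + pairTop L κ) ε₀
  plaqU₁ : B8Lemma1NonAbelian.PlaqSmall U₁ y (y + pairTop L κ) ε₀
  avgAxial : ∀ r : Fin d → Fin L, ‖((avgAxialFn U y (y + boxVec L r) : 𝔸ˣ) : 𝔸) - 1‖ ≤ ε₀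
  avgAxial₁ : ∀ r : Fin d → Fin L,
    ‖((avgAxialFn U (y + (L : ℤ) • e κ) (y + (L : ℤ) • e κ + boxVec L r) : 𝔸ˣ) : 𝔸) - 1‖ ≤ ε₀
  axial : ∀ r : Fin d → Fin L, axialFn U₁ y (y + boxVec L r) = 1
  axial₁ : ∀ r : Fin d → Fin L, axialFn U₁ (y + (L : ℤ) • e κ) (y + (L : ℤ) • e κ + boxVec L r) = 1
  avg : bavg L U y κ = bavg L U₁ y κ

/-- The second block `B(c₊) = (y + Le_κ) + [0,L)^d` lies in the pair's box `[y, y + pairTop L κ]`. [cite: Balaban1985RegularSpaces, (1.23) p.79] -/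
theorem shift_boxVec_le_pairTop (L : ℕ) (y : B7Prop1Explicit.Site d) (κ : Fin d) (r : Fin d → Fin L) :
    y + (L : ℤ) • e κ + boxVec L r ≤ y + pairTop L κ := by
  intro κ'; have := (r κ').isLt
  simp only [Pi.add_apply, boxVec, zsmul_e_apply, pairTop]
  split_ifs <;> omega

/-- **`χ_Ax` on the averaged variables gives the soft axial hypotheses of `lemma1_soft`** with `τ = ε₀ + 4(dL)²ε₀`, `a = ε₀`,
`α₁ = 0`, provided `(dL)²ε₀ ≤ 1/100`. [cite: Balaban1988Convergent, (1.5) p.247] -/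
theorem Hyp247Avg.toHypSoft {L : ℕ} {U U₁ : B7Prop1Explicit.Site d → Fin d → 𝔸ˣ} {y : B7Prop1Explicit.Site d} {κ : Fin d} {ε₀ : ℝ}
    (H : Hyp247Avg L U U₁ y κ ε₀) (hε₀ : 0 ≤ ε₀) (hsm : ((d : ℝ) * L) ^ 2 * ε₀ ≤ 1 / 100) :
    HypSoft L U U₁ y κ ε₀ 0 (ε₀ + 4 * (((d : ℝ) * L) ^ 2 * ε₀)) where
  memU := H.memU
  memV₀ := H.memU₁
  plaqU := H.plaqU
  plaqV₀ := H.plaqU₁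
  axial r := by
    rw [H.axial r, Units.val_one]
    exact norm_axialFn_sub_one_le_of_avg_block H.memU H.plaqU hε₀ r le_rfl
      (add_le_add_right (boxVec_le_pairTop L κ r) y) hsm (H.avgAxial r)
  axial₁ r := by
    rw [H.axial₁ r, Units.val_one]
    exact norm_axialFn_sub_one_le_of_avg_block H.memU H.plaqU hε₀ r
      (le_add_of_nonneg_right (zsmul_e_nonneg (by positivity) κ)) (shift_boxVec_le_pairTop L y κ r) hsm (H.avgAxial₁ r)
  avg := by rw [H.avg, sub_self, norm_zero]

/-- **p. 247 with the printed `χ_Ax`, explicit form** ("by the same reasoning as in the proof of Lemma 1 [14]"): under `Hyp247Avg`,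
`6(d−1)(L−1)Lε₀ ≤ 1` and `(dL)²ε₀ ≤ 1/100`, every bond `b = ⟨x, x + e_ν⟩` of the block pair satisfies `‖U_b U₁,b⁻¹ − 1‖ ≤
10·(d−1)(L−1)L·ε₀ + 2ε₀ + 8(dL)²ε₀`. [cite: Balaban1988Convergent, p.247] -/
theorem claim247_avg_explicit {L : ℕ} (hL : 1 ≤ L) {U U₁ : B7Prop1Explicit.Site d → Fin d → 𝔸ˣ} {y : B7Prop1Explicit.Site d} {κ : Fin d} {ε₀ : ℝ}
    (H : Hyp247Avg L U U₁ y κ ε₀) (hε₀ : 0 ≤ ε₀) (hω : 6 * omegaC d L ε₀ ≤ 1) (hsm : ((d : ℝ) * L) ^ 2 * ε₀ ≤ 1 / 100)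
    (x : B7Prop1Explicit.Site d) (ν : Fin d) (hx : InPair L y κ x) (hxν : InPair L y κ (x + e ν)) :
    ‖((pert U U₁ x ν : 𝔸ˣ) : 𝔸) - 1‖ ≤ 10 * omegaC d L ε₀ + 2 * ε₀ + 8 * (((d : ℝ) * L) ^ 2 * ε₀) := by
  have h := lemma1_soft hL (H.toHypSoft hε₀ hsm) hε₀ le_rfl hω x ν hx hxν
  have h' : (0 : ℝ) + omegaC d L ε₀ * (10 + 12 * 0) + 2 * (ε₀ + 4 * (((d : ℝ) * L) ^ 2 * ε₀)) =
      10 * omegaC d L ε₀ + 2 * ε₀ + 8 * (((d : ℝ) * L) ^ 2 * ε₀) := by ring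
  rwa [h'] at h

end Model

/-! ## §4 The printed form -/

section Printed

/-- **B14 p. 247 (verbatim): *"A good approximation on a cube □′ ⊂ B(P₁¹) is given by UU_{1,□′}⁻¹, where U_{1,□′} is taken in
the axial gauge. It is easy to see, by the same reasoning as in the proof of Lemma 1 [14], that |UU_{1,□′}⁻¹ − 1| < O(L²)ε₀ on
□′^{~2}."*** — over the block-pair model with the PRINTED gauge conditions `Hyp247Avg` (`U_{1,□′}` axial; `U` restricted by the
`χ_Ax` of (1.5) on the averaged contour variables (0.11) [I]): there are constants `C, c > 0` such that for every block side `L ≥ 1`,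
every `ε₀ > 0` with `L²ε₀ ≤ c`, every pair `(U, U₁)` satisfying the hypotheses and every bond `b` of the pair, `|U_b U₁,b⁻¹ − 1| <
C·L²·ε₀`. [cite: Balaban1988Convergent, p.247] -/
def Claim247AvgPrinted (d : ℕ) (𝔸 : Type*) [NormedRing 𝔸] [NormOneClass 𝔸] [NormedAlgebra ℂ 𝔸] [CompleteSpace 𝔸] : Prop :=
  ∃ C c : ℝ, 0 < C ∧ 0 < c ∧ ∀ L : ℕ, 1 ≤ L → ∀ ε₀ : ℝ, 0 < ε₀ → (L : ℝ) ^ 2 * ε₀ ≤ c →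
    ∀ (U U₁ : B7Prop1Explicit.Site d → Fin d → 𝔸ˣ) (y : B7Prop1Explicit.Site d) (κ : Fin d), Hyp247Avg L U U₁ y κ ε₀ →
      ∀ (x : B7Prop1Explicit.Site d) (ν : Fin d), InPair L y κ x → InPair L y κ (x + e ν) →
        ‖((pert U U₁ x ν : 𝔸ˣ) : 𝔸) - 1‖ < C * (L : ℝ) ^ 2 * ε₀

/-- **`Claim247AvgPrinted` HOLDS**, with `C = 8d² + 10d + 1`, `c = 1/(100(d+1)²)`: `L²ε₀ ≤ c` gives `(dL)²ε₀ ≤ 1/100` and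
`6(d−1)(L−1)Lε₀ ≤ 1`, and `10(d−1)(L−1)Lε₀ + 2ε₀ + 8(dL)²ε₀ ≤ (8d² + 10d − 8)L²ε₀ < (8d² + 10d + 1)L²ε₀`.
[cite: Balaban1988Convergent, p.247] -/
theorem Claim247AvgPrinted_holds (d : ℕ) (𝔸 : Type*) [NormedRing 𝔸] [NormOneClass 𝔸] [NormedAlgebra ℂ 𝔸]
    [CompleteSpace 𝔸] : Claim247AvgPrinted d 𝔸 := by
  refine ⟨8 * (d : ℝ) ^ 2 + 10 * (d : ℝ) + 1, 1 / (100 * ((d : ℝ) + 1) ^ 2), by positivity, by positivity, ?_⟩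
  intro L hL ε₀ hε₀ hsmall U U₁ y κ H x ν hx hxν
  rcases Nat.eq_zero_or_pos d with hd0 | hd
  · subst hd0; exact Fin.elim0 κ
  have h1 : (1 : ℝ) ≤ L := by exact_mod_cast hL
  have h2 : (1 : ℝ) ≤ d := by exact_mod_cast hd
  have hd1 : (0 : ℝ) ≤ (d : ℝ) - 1 := by linarith
  have hL2 : 0 < (L : ℝ) ^ 2 * ε₀ := by positivity
  -- `(dL)²ε₀ = d²·(L²ε₀) ≤ d²/(100(d+1)²) ≤ 1/100`
  have hsm : ((d : ℝ) * L) ^ 2 * ε₀ ≤ 1 / 100 := by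
    have hc : (d : ℝ) ^ 2 * ((L : ℝ) ^ 2 * ε₀) ≤ (d : ℝ) ^ 2 * (1 / (100 * ((d : ℝ) + 1) ^ 2)) :=
      mul_le_mul_of_nonneg_left hsmall (by positivity)
    have hq : (d : ℝ) ^ 2 * (1 / (100 * ((d : ℝ) + 1) ^ 2)) ≤ 1 / 100 := by
      rw [show (d : ℝ) ^ 2 * (1 / (100 * ((d : ℝ) + 1) ^ 2)) = ((d : ℝ) ^ 2 / ((d : ℝ) + 1) ^ 2) / 100 by
        field_simp]
      have : (d : ℝ) ^ 2 / ((d : ℝ) + 1) ^ 2 ≤ 1 := by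
        rw [div_le_one (by positivity)]; nlinarith
      linarith
    calc ((d : ℝ) * L) ^ 2 * ε₀ = (d : ℝ) ^ 2 * ((L : ℝ) ^ 2 * ε₀) := by ring
      _ ≤ _ := hc.trans hq
  -- `6ω ≤ 6(d−1)L²ε₀ ≤ 6(d−1)/(100(d+1)²) ≤ 1`
  have h10 := ten_omegaC_le (L := L) hd hε₀.le
  have hω : omegaC d L ε₀ ≤ ((d : ℝ) - 1) * ((L : ℝ) ^ 2 * ε₀) := by nlinarith
  have hω1 : 6 * omegaC d L ε₀ ≤ 1 := by
    have hc : ((d : ℝ) - 1) * ((L : ℝ) ^ 2 * ε₀) ≤ ((d : ℝ) - 1) * (1 / (100 * ((d : ℝ) + 1) ^ 2)) :=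
      mul_le_mul_of_nonneg_left hsmall hd1
    have hq : 6 * (((d : ℝ) - 1) * (1 / (100 * ((d : ℝ) + 1) ^ 2))) ≤ 1 := by
      rw [show 6 * (((d : ℝ) - 1) * (1 / (100 * ((d : ℝ) + 1) ^ 2))) = (6 * ((d : ℝ) - 1)) / (100 * ((d : ℝ) + 1) ^ 2) by
        field_simp]
      rw [div_le_one (by positivity)]
      nlinarith
    linarith
  have hb := claim247_avg_explicit hL H hε₀.le hω1 hsm x ν hx hxν
  -- `2ε₀ ≤ 2L²ε₀`, `8(dL)²ε₀ = 8d²L²ε₀`, `10ω ≤ 10(d−1)L²ε₀`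
  have hL1 : (1 : ℝ) ≤ (L : ℝ) ^ 2 := by nlinarith
  have h2ε : ε₀ ≤ (L : ℝ) ^ 2 * ε₀ := le_mul_of_one_le_left hε₀.le hL1
  have hdl : ((d : ℝ) * L) ^ 2 * ε₀ = (d : ℝ) ^ 2 * ((L : ℝ) ^ 2 * ε₀) := by ring
  have hlt : 10 * omegaC d L ε₀ + 2 * ε₀ + 8 * (((d : ℝ) * L) ^ 2 * ε₀) <
      (8 * (d : ℝ) ^ 2 + 10 * (d : ℝ) + 1) * (L : ℝ) ^ 2 * ε₀ := by
    rw [hdl]; nlinarith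
  exact lt_of_le_of_lt hb hlt

/-- The averaged-`χ_Ax` hypotheses imply the tree-contour soft-axial hypotheses of `B14Claim247Soft` with the constant `ε₀ + 4(dL)²ε₀`
in place of `ε₀` — i.e. the printed situation is a case of generation 1's `HypSoft` (with `τ` the honest discrepancy), as announced
in (D1′) there. [cite: Balaban1988Convergent, (1.5) p.247] -/
theorem hypSoft_of_hyp247Avg {𝔸 : Type*} [NormedRing 𝔸] [NormOneClass 𝔸] [NormedAlgebra ℂ 𝔸] [CompleteSpace 𝔸] {L : ℕ}
    {U U₁ : B7Prop1Explicit.Site d → Fin d → 𝔸ˣ} {y : B7Prop1Explicit.Site d} {κ : Fin d} {ε₀ : ℝ} (H : Hyp247Avg L U U₁ y κ ε₀) (hε₀ : 0 ≤ ε₀)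
    (hsm : ((d : ℝ) * L) ^ 2 * ε₀ ≤ 1 / 100) : HypSoft L U U₁ y κ ε₀ 0 (ε₀ + 4 * (((d : ℝ) * L) ^ 2 * ε₀)) :=
  H.toHypSoft hε₀ hsm

end Printed

end Literature.MathematicalPhysics.QuantumFieldTheory.Balaban1983to89.B14Claim247Avg
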